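import Summits.KontsevichZagierPeriods.Zeta5Search.Certificates.TwoTaleOmegaRules

/-!
# ζ(2) two-tale line — coverage of Ω by the step rules: Lemma C1 and the finiteness box of the BASE (cell `pub-zeta5`, `cert-2`)

HONEST FRAMING: systematic search; recurrence certificates; no irrationality claim unless certified.

fam-tele gen 3, `certs/tele/bmiss_general/PROOF.md` §5: LEMMA C1 — `Ω(a) = ∅` for `a ≤ 2` (`three_le_a`), and for `b ≥ 2a+8` one of
the rules `g, b, bg` is applicable (`rule_exists_large_b`; the `bg` case occurs only for `a = 3`).  With `TwoTaleOmegaRules.rule_exists`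
(`a ≥ 17`) this puts every point of `Ω` WITHOUT an applicable rule into the box `3 ≤ a ≤ 16`, `b ≤ 2a+7`, `e, f ≤ a`, `g ≤ 5a+6`
(`no_rule_box`) — the applicability half of "BASE is finite" (PROOF.md §5; the other half, the 63 EXC points where the selected step is
not certified, belongs to the analytic layer (S2) and is not formalised).  Linear arithmetic only (`omega`).
-/

namespace Summit.KontsevichZagierPeriods.Zeta5Search.Certificates

namespace TwoTaleTelescope

/-- Components of `p − k·δ` for direction `bg`. -/
theorem shift_BG (p : Pt) (k : ℤ) :
    (p - k • dirBG) 0 = p 0 ∧ (p - k • dirBG) 1 = p 1 - k ∧ (p - k • dirBG) 2 = p 2 ∧ (p - k • dirBG) 3 = p 3 ∧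
      (p - k • dirBG) 4 = p 4 - k := by
  simp [dirBG, Pi.sub_apply]

/-- LEMMA C1 (i): `Ω(a)` is empty for `a ≤ 2`, i.e. `a ≥ 3` on `Ω`. -/
theorem three_le_a (p : Pt) (hp : p ∈ Omega) : 3 ≤ p 0 := by
  rw [mem_Omega] at hp; omega

/-- LEMMA C1 (ii): for `b ≥ 2a + 8` one of the rules `g`, `b`, `bg` is applicable at `p ∈ Ω`. -/
theorem rule_exists_large_b (p : Pt) (hp : p ∈ Omega) (hb : 2 * p 0 + 8 ≤ p 1) :
    p ∈ App dirG ∨ p ∈ App dirB ∨ p ∈ App dirBG := by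
  have hp' := hp
  rw [mem_Omega] at hp'
  by_cases h1 : p 1 + 6 ≤ p 4
  · -- rule g: lowering g by ≤ 3 keeps g ≥ max(a,b)+1 and g ≥ b+3
    refine Or.inl fun k hk => ?_
    rw [mem_Omega]
    obtain ⟨e0, e1, e2, e3, e4⟩ := shift_G p k
    rw [e0, e1, e2, e3, e4]
    have hk' : (k : ℤ) ≤ 3 := by exact_mod_cast hk
    have hk0 : (0 : ℤ) ≤ k := by exact_mod_cast Nat.zero_le k
    omega
  · by_cases h2 : p 4 ≤ 2 * p 2 + 2 * p 3 + p 1 - p 0 - 4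
    · -- rule b
      refine Or.inr (Or.inl fun k hk => ?_)
      rw [mem_Omega]
      obtain ⟨e0, e1, e2, e3, e4⟩ := shift_B p k
      rw [e0, e1, e2, e3, e4]
      have hk' : (k : ℤ) ≤ 3 := by exact_mod_cast hk
      have hk0 : (0 : ℤ) ≤ k := by exact_mod_cast Nat.zero_le k
      omega
    · -- the residual case forces a = 3, {e,f} = {2,3}, g ∈ {b+4, b+5}: rule bg
      refine Or.inr (Or.inr fun k hk => ?_)
      rw [mem_Omega]
      obtain ⟨e0, e1, e2, e3, e4⟩ := shift_BG p k
      rw [e0, e1, e2, e3, e4]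
      have hk' : (k : ℤ) ≤ 3 := by exact_mod_cast hk
      have hk0 : (0 : ℤ) ≤ k := by exact_mod_cast Nat.zero_le k
      omega

/-- **The no-rule box** (PROOF.md §5: "BASE ⊂ {a ≤ 16} ∩ {b ≤ 2a+7}, a finite set" — applicability half): a point of `Ω` at which none
of the seven rules is applicable satisfies `3 ≤ a ≤ 16`, `b ≤ 2a + 7`, `e ≤ a`, `f ≤ a`, `g ≤ 5a + 6`. -/
theorem no_rule_box (p : Pt) (hp : p ∈ Omega) (h : ∀ δ ∈ dirs, p ∉ App δ) :
    3 ≤ p 0 ∧ p 0 ≤ 16 ∧ p 1 ≤ 2 * p 0 + 7 ∧ p 2 ≤ p 0 ∧ p 3 ≤ p 0 ∧ p 4 ≤ 5 * p 0 + 6 := by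
  have hG : p ∉ App dirG := h dirG (by simp [dirs])
  have hB : p ∉ App dirB := h dirB (by simp [dirs])
  have hE : p ∉ App dirE := h dirE (by simp [dirs])
  have hF : p ∉ App dirF := h dirF (by simp [dirs])
  have hA : p ∉ App dirA := h dirA (by simp [dirs])
  have hAEF : p ∉ App dirAEF := h dirAEF (by simp [dirs])
  have hBG : p ∉ App dirBG := h dirBG (by simp [dirs])
  have h3 := three_le_a p hp
  have ha : p 0 ≤ 16 := by
    by_contra hc
    rcases rule_exists p hp (by omega) with h' | h' | h' | h' | h' | h' <;> contradiction
  have hb : p 1 ≤ 2 * p 0 + 7 := by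
    by_contra hc
    rcases rule_exists_large_b p hp (by omega) with h' | h' | h' <;> contradiction
  rw [mem_Omega] at hp
  omega

end TwoTaleTelescope

end Summit.KontsevichZagierPeriods.Zeta5Search.Certificates
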